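import Mathlib
import HarnessLib

/-!
# Ring 2 · AbelianAll (ab-weil-1, gen 16, part 12) — a stable Lagrangian is cut into Lagrangians:
  the linear-algebra core of "Prym pieces of BOUNDING étale Galois covers are of SPLIT Weil type"

research route, not a corollary; conditional on HC_CM plus one named minimal statement.
Cell line: research route conditional on HC_CM; not a corollary; Q11.4-sentence-2 already refuted in dim ≥ 3.
`HC_CM` (`Theses.RankFourFaces.CMAbelianHodge`) does not occur in this file and no open case of the Hodge
conjecture is claimed.  Everything PROVED here is finite-dimensional linear algebra over a field (Mathlib only);
the geometric reading below is the seat's gen-16 note `HECKE-PRYM-ANCHORS-G16.md` (pub-hodge-ring2, seat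
ab-weil-1) and is NOT formalised here.

## What is proved (kernel)

Let `B` be a reflexive bilinear form on a finite-dimensional `K`-vector space `V`, `L ≤ V` an isotropic
subspace of HALF dimension (`2·dim L = dim V`, a "Lagrangian"), and `e : V →ₗ V` an endomorphism with
`e(L) ≤ L` such that `B` is non-degenerate on `range e` and on `ker e`.  Then `e(L)` is an isotropic subspace
of `range e` of EXACTLY half its dimension (`isotropic_half_of_stable_lagrangian`):
`L ↠ e(L)` with kernel `L ⊓ ker e`, both pieces are isotropic inside a non-degenerate space, so each has at
most half the ambient dimension (`two_mul_finrank_le_of_isotropic[_of_le]`), and the two halves add up to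
`dim L = ½ dim V = ½ (dim range e + dim ker e)` — forcing equality in both.  When `B` is non-degenerate on
`V` and `e` is a `B`-self-adjoint idempotent, the two non-degeneracy hypotheses are automatic
(`isotropic_half_of_stable_lagrangian_of_isSelfAdjoint`), and `e(L) = L ⊓ range e`
(`map_eq_inf_range_of_idempotent`).  Any operator of the form `e ∘ a ∘ e` with `a(L) ≤ L` preserves `e(L)`
(`comp_mem_map_of_stable`) — this is how a commutative subalgebra `K' ⊆ e·ℚ[G]·e` keeps the half-dimensional
isotropic subspace stable.

## Geometric reading (paper; gen-16 note, NOT a kernel statement)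

`V = H₁(C̃; ℚ)` of an étale Galois `G`-cover `C̃ → C'` of a smooth projective curve, `B` = intersection
form (`G`-invariant, symplectic), `e ∈ ℚ[G] ⊆ End⁰ J(C̃)` a Rosati-symmetric idempotent (`e† = e`, Rosati =
`g ↦ g⁻¹`; e.g. `e = e_W·e_H` for a central idempotent `e_W` and `e_H = |H|⁻¹ Σ_{h ∈ H} h`), `P = Im e` the
corresponding Prym / Hecke–Prym piece with its induced polarization (`H₁(P; ℚ) = e·V`, form `B|`).  IF the
class of `(C', ρ)` in `H₂(G; ℤ) ≅ Ω₂^{SO}(BG)` vanishes — automatic when the Schur multiplier `H₂(G; ℤ)` is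
`0` (all Frobenius groups `ℤ/p ⋊ ℤ/m` incl. `F₂₁`, `F₅₅`; the semidihedral group `SD₁₆`; `SL₂(𝔽₇)`), and
for every "handlebody" monodromy `ρ(a₁) = ⋯ = ρ(a_{g'}) = 1` — then `C̃ = ∂M̃` for the induced `G`-cover
`M̃` of a null-bordism `M³`, and `L := ker (H₁(C̃; ℚ) → H₁(M̃; ℚ))` is a `G`-STABLE LAGRANGIAN
("half lives, half dies").  The theorem then says: `H₁(P; ℚ)` contains a rational isotropic subspace of half
dimension stable under `e·ℚ[G]·e ⊇ K`, so the `K`-Hermitian form of the polarization on `H₁(P; ℚ)` is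
HYPERBOLIC (Witt index `n`, discriminant class `(-1)ⁿ`); hence IF `(P, K, Θ|_P)` is of Weil type (signature
`(n,n)` of the `K`-action — for imaginary quadratic `K` this is implied by hyperbolicity, since the Hermitian
signature equals the tangent-space signature) it is of SPLIT Weil type — the tree's
`Motives.IsHyperbolicWeilType` shape.  This YIELDS, MODULO THE UN-FORMALISED GEOMETRIC STEPS (i) Chevalley–Weil,
(ii) the induced `G`-cover of a null-bordism, (iii) `L = ker(H₁(∂M̃) → H₁(M̃))` is a `G`-stable Lagrangian,
(iv) the passage from `B`-isotropic-and-`K`-stable to `H`-isotropic, the bounding-cover case of the conjecture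
recorded by the refuter of crux `HeckePrymWeil.WeilSixfoldsSqrtMinus7` (`Cruxes/WeilSixfoldsSqrtMinus7/
HeckePrymSplit.md`, Consequence 3: every computed Hecke–Prym is split — `F₂₁` 81/81 and 3/3, `F₅₅` 2/2 there;
the `SL₂(𝔽₇)` 21/21 and `SL₂(𝔽₁₁)` 3/3 rows are in the sibling file `Cruxes/WeilSixfoldsSqrtMinus7/
SL2PrymSplit.md`; all these groups have `H₂ = 0`).  The NON-bounding covers (`H₂(G; ℤ) ≠ 0`, e.g.
`G_K = ℤ/20 ⋊ ℤ/4` for `K = ℚ(√-5)`) are treated in the gen-16 note, §2 Theorems B/B′/C (paper): the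
normalised discriminant is a character of `Ω₂^{SO}(BG)` factoring through the dual Bogomolov multiplier of
`G/ker χ`, trivial on 2-parts whenever `χ(1) ≤ 3` — so every Weil-type piece of dimension `4` or `6` of an
étale Galois cover is split (again NOT formalised; kernel content of this file unchanged).
Docstring revision (gen 16, rev 2): wording of the two sentences above per referee findings F-ab-72 (R-25) and
F-ref2-63 (a)(b) (ref2 gen 56); NO declaration, statement or proof changed.

Sources for the reading: Chevalley–Weil; Poincaré–Lefschetz duality for `∂M̃ ⊂ M̃`;
`Ω₂^{SO}(BG) = H₂(G; ℤ)`; Lange–Rodríguez, *Decomposition of Jacobians by Prym varieties* (LNM 2310, 2022),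
Ch. 2–3 (group-algebra decomposition, Rosati-symmetric idempotents); Boggi–Looijenga, Math. Ann. (2021),
arXiv:1811.09741 §3 (a `G`-orbit of lifted curves with trivial monodromy spans an isotropic subspace).
-/

set_option linter.dupNamespace false

namespace Summit.HodgeConjecture.HodgeConjecture.Ring2.AbelianAll

open Module

section IsotropicHalf

variable {K V : Type*} [Field K] [AddCommGroup V] [Module K V] [FiniteDimensional K V]

/-- **Isotropic subspaces have at most half the dimension.**  For a reflexive bilinear form `B` on a
finite-dimensional space `V` that is left-separating (`B x · = 0 ⟹ x = 0`), every isotropic subspace `U`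
(`B` vanishes on `U × U`) satisfies `2·dim U ≤ dim V`.  (Mathlib's
`LinearMap.BilinForm.finrank_add_finrank_orthogonal` with `U ≤ Uᗮ`.) -/
theorem two_mul_finrank_le_of_isotropic (B : LinearMap.BilinForm K V) (hB : B.IsRefl)
    (hnd : ∀ x : V, (∀ y : V, B x y = 0) → x = 0)
    (U : Submodule K V) (hU : ∀ x ∈ U, ∀ y ∈ U, B x y = 0) :
    2 * finrank K U ≤ finrank K V := by
  have h1 : U ≤ B.orthogonal U := by
    intro m hm
    rw [LinearMap.BilinForm.mem_orthogonal_iff]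
    intro n hn
    exact hU n hn m hm
  have h2 : (U ⊓ B.orthogonal ⊤ : Submodule K V) = ⊥ := by
    rw [eq_bot_iff]
    intro x hx
    rw [Submodule.mem_bot]
    have hx' : x ∈ B.orthogonal ⊤ := (Submodule.mem_inf.mp hx).2
    rw [LinearMap.BilinForm.mem_orthogonal_iff] at hx'
    exact hnd x fun y => hB _ _ (hx' y Submodule.mem_top)
  have h3 := LinearMap.BilinForm.finrank_add_finrank_orthogonal hB U
  rw [h2, finrank_bot, add_zero] at h3
  have h4 : finrank K U ≤ finrank K (B.orthogonal U) := Submodule.finrank_mono h1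
  omega

/-- Relative version of `two_mul_finrank_le_of_isotropic`: if `B` (reflexive) is left-separating ON a
subspace `W` (`x ∈ W`, `B x y = 0` for all `y ∈ W` `⟹ x = 0`), then every isotropic `U ≤ W` has
`2·dim U ≤ dim W`. -/
theorem two_mul_finrank_le_of_isotropic_of_le (B : LinearMap.BilinForm K V) (hB : B.IsRefl)
    (W : Submodule K V) (hW : ∀ x ∈ W, (∀ y ∈ W, B x y = 0) → x = 0)
    (U : Submodule K V) (hUW : U ≤ W) (hU : ∀ x ∈ U, ∀ y ∈ U, B x y = 0) :
    2 * finrank K U ≤ finrank K W := by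
  have hB' : (B.restrict W).IsRefl := by
    intro x y h
    simp only [LinearMap.BilinForm.restrict_apply] at h ⊢
    exact hB _ _ h
  have hnd' : ∀ x : W, (∀ y : W, (B.restrict W) x y = 0) → x = 0 := by
    intro x hx
    have hx0 : (x : V) = 0 := by
      refine hW x x.2 fun y hy => ?_
      have := hx ⟨y, hy⟩
      simpa [LinearMap.BilinForm.restrict_apply] using this
    exact Subtype.ext (by simpa using hx0)
  have hiso' : ∀ x ∈ U.comap W.subtype, ∀ y ∈ U.comap W.subtype, (B.restrict W) x y = 0 := by
    intro x hx y hy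
    simp only [LinearMap.BilinForm.restrict_apply]
    rw [Submodule.mem_comap] at hx hy
    simpa using hU _ hx _ hy
  have h := two_mul_finrank_le_of_isotropic (B.restrict W) hB' hnd' (U.comap W.subtype) hiso'
  have hfin : finrank K (U.comap W.subtype) = finrank K U :=
    (Submodule.comapSubtypeEquivOfLe hUW).finrank_eq
  omega

/-- **A stable Lagrangian is cut into Lagrangians.**  `B` reflexive on `V`; `L` isotropic of half
dimension; `e : V →ₗ V` with `e(L) ≤ L`; `B` left-separating on `range e` and on `ker e`.  Then `e(L)` is
an isotropic subspace of `range e` with `2·dim e(L) = dim (range e)` (and, by the same count,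
`2·dim (L ⊓ ker e) = dim (ker e)`).  Geometric reading: module docstring (`V = H₁(C̃; ℚ)`, `L` the
Lagrangian of a bounding `3`-manifold, `e ∈ ℚ[G]` a Rosati-symmetric idempotent, `range e = H₁(P; ℚ)` of the
Prym piece `P`: the piece is of split Weil type). -/
theorem isotropic_half_of_stable_lagrangian (B : LinearMap.BilinForm K V) (hB : B.IsRefl)
    (e : V →ₗ[K] V)
    (hran : ∀ x ∈ LinearMap.range e, (∀ y ∈ LinearMap.range e, B x y = 0) → x = 0)
    (hker : ∀ x ∈ LinearMap.ker e, (∀ y ∈ LinearMap.ker e, B x y = 0) → x = 0)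
    (L : Submodule K V) (hLiso : ∀ x ∈ L, ∀ y ∈ L, B x y = 0)
    (hLdim : 2 * finrank K L = finrank K V) (hLe : ∀ x ∈ L, e x ∈ L) :
    L.map e ≤ LinearMap.range e ∧ (∀ x ∈ L.map e, ∀ y ∈ L.map e, B x y = 0) ∧
      2 * finrank K (L.map e) = finrank K (LinearMap.range e) ∧
      2 * finrank K (L ⊓ LinearMap.ker e : Submodule K V) = finrank K (LinearMap.ker e) := by
  have h1 : L.map e ≤ LinearMap.range e := LinearMap.map_le_range
  have h2 : L.map e ≤ L := by
    rintro _ ⟨x, hx, rfl⟩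
    exact hLe x hx
  have hiso1 : ∀ x ∈ L.map e, ∀ y ∈ L.map e, B x y = 0 :=
    fun x hx y hy => hLiso x (h2 hx) y (h2 hy)
  have hiso2 : ∀ x ∈ (L ⊓ LinearMap.ker e : Submodule K V), ∀ y ∈ (L ⊓ LinearMap.ker e : Submodule K V),
      B x y = 0 :=
    fun x hx y hy => hLiso x hx.1 y hy.1
  have hA := two_mul_finrank_le_of_isotropic_of_le B hB (LinearMap.range e) hran (L.map e) h1 hiso1
  have hK := two_mul_finrank_le_of_isotropic_of_le B hB (LinearMap.ker e) hker
    (L ⊓ LinearMap.ker e) inf_le_right hiso2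
  have h5 : finrank K (L.map e) + finrank K (L ⊓ LinearMap.ker e : Submodule K V) = finrank K L := by
    have hrk := LinearMap.finrank_range_add_finrank_ker (e.domRestrict L)
    rw [LinearMap.range_domRestrict, LinearMap.ker_domRestrict] at hrk
    have hc : finrank K ((LinearMap.ker e).comap L.subtype) =
        finrank K (L ⊓ LinearMap.ker e : Submodule K V) := by
      have heq : (LinearMap.ker e).comap L.subtype = (L ⊓ LinearMap.ker e).comap L.subtype := by
        ext x
        simp only [Submodule.mem_comap, Submodule.coe_subtype, Submodule.mem_inf]
        exact ⟨fun h => ⟨x.2, h⟩, fun h => h.2⟩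
      rw [heq]
      exact (Submodule.comapSubtypeEquivOfLe inf_le_left).finrank_eq
    omega
  have h6 := LinearMap.finrank_range_add_finrank_ker e
  refine ⟨h1, hiso1, ?_, ?_⟩ <;> omega

omit [FiniteDimensional K V] in
/-- For an idempotent `e` with `e(L) ≤ L`, the image `e(L)` is `L ⊓ range e` — in the geometric reading,
the half-dimensional isotropic subspace of `H₁(P; ℚ) = range e` is just `L ∩ H₁(P; ℚ)`. -/
theorem map_eq_inf_range_of_idempotent (e : V →ₗ[K] V) (he : ∀ x, e (e x) = e x)
    (L : Submodule K V) (hLe : ∀ x ∈ L, e x ∈ L) :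
    L.map e = L ⊓ LinearMap.range e := by
  apply le_antisymm
  · rintro _ ⟨x, hx, rfl⟩
    exact ⟨hLe x hx, LinearMap.mem_range_self e x⟩
  · rintro x ⟨hxL, ⟨y, rfl⟩⟩
    exact ⟨e y, hxL, he y⟩

omit [FiniteDimensional K V] in
/-- Stability: any operator `e ∘ a ∘ e` with `a(L) ≤ L` (e.g. a Hecke element of `e·ℚ[G]·e` for a
`G`-stable `L`) maps `e(L)` into itself, provided `e` is idempotent and `e(L) ≤ L`. -/
theorem comp_mem_map_of_stable (e a : V →ₗ[K] V) (he : ∀ x, e (e x) = e x)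
    (L : Submodule K V) (hLe : ∀ x ∈ L, e x ∈ L) (hLa : ∀ x ∈ L, a x ∈ L)
    {x : V} (hx : x ∈ L.map e) : e (a (e x)) ∈ L.map e := by
  obtain ⟨y, hy, rfl⟩ := hx
  refine ⟨a (e y), hLa _ (hLe y hy), ?_⟩
  rw [he]

/-- **Self-adjoint idempotents.**  If `B` is reflexive and left-separating on all of `V`, and `e` is an
idempotent that is `B`-self-adjoint (`B (e x) y = B x (e y)` — the Rosati-symmetric idempotents of the
geometric reading), then `B` is left-separating on `range e` and on `ker e`; hence
`isotropic_half_of_stable_lagrangian` applies to every `e`-stable Lagrangian `L`. -/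
theorem isotropic_half_of_stable_lagrangian_of_isSelfAdjoint (B : LinearMap.BilinForm K V)
    (hB : B.IsRefl) (hnd : ∀ x : V, (∀ y : V, B x y = 0) → x = 0)
    (e : V →ₗ[K] V) (he : ∀ x, e (e x) = e x) (hadj : ∀ x y, B (e x) y = B x (e y))
    (L : Submodule K V) (hLiso : ∀ x ∈ L, ∀ y ∈ L, B x y = 0)
    (hLdim : 2 * finrank K L = finrank K V) (hLe : ∀ x ∈ L, e x ∈ L) :
    L.map e ≤ LinearMap.range e ∧ (∀ x ∈ L.map e, ∀ y ∈ L.map e, B x y = 0) ∧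
      2 * finrank K (L.map e) = finrank K (LinearMap.range e) ∧
      2 * finrank K (L ⊓ LinearMap.ker e : Submodule K V) = finrank K (LinearMap.ker e) := by
  have hran : ∀ x ∈ LinearMap.range e, (∀ y ∈ LinearMap.range e, B x y = 0) → x = 0 := by
    rintro _ ⟨x', rfl⟩ h
    apply hnd
    intro v
    have hv : B (e x') (e v) = 0 := h (e v) (LinearMap.mem_range_self e v)
    calc B (e x') v = B (e (e x')) v := by rw [he]
      _ = B (e x') (e v) := hadj (e x') v
      _ = 0 := hv
  have hker : ∀ x ∈ LinearMap.ker e, (∀ y ∈ LinearMap.ker e, B x y = 0) → x = 0 := by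
    intro x hx h
    rw [LinearMap.mem_ker] at hx
    apply hnd
    intro v
    have hv : v - e v ∈ LinearMap.ker e := by
      rw [LinearMap.mem_ker, map_sub, he, sub_self]
    have h0 : B x (v - e v) = 0 := h _ hv
    have h1 : B x (e v) = 0 := by
      rw [← hadj, hx, LinearMap.map_zero, LinearMap.zero_apply]
    have : B x v = B x (v - e v) + B x (e v) := by
      rw [map_sub, sub_add_cancel]
    rw [this, h0, h1, add_zero]
  exact isotropic_half_of_stable_lagrangian B hB e hran hker L hLiso hLdim hLe

end IsotropicHalf

end Summit.HodgeConjecture.HodgeConjecture.Ring2.AbelianAll
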